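import Summits.Langlands.Langlands.Theses.PrimitiveCompanionReduction
import Summits.Langlands.Langlands.Theorems.LevelOneDyadicPrimitiveProofs

/-!
# TP `PrimitiveCompanionReduction.KroneckerCompanionCell` (stmt-Langlands-27500) — PROVED

The Kronecker cell of the companion box (route-Langlands-PrimitiveCompanionReduction rev 0, crux 3; decomp-langlands lens-4 g13
node `PrimitiveCompanionCore` v2): for ρ in R's box whose characteristic polynomials are those of a Kronecker product σ₁ ⊗ σ₂ of two
irreducible, Lie-irreducible, level-one factors of dimensions a, b ≥ 2, GIVEN R on every slice lexicographically below (n, [K:ℚ]),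
ρ has an a.e.-unramified 2-adic companion.  Proof = LevelOneDyadic part 9b `Primitive.kroneckerCompanionCell_holds` (companions of
the factors by the carried IH, Kronecker product of the companions, Newton-identity seam); the route item is the node text verbatim.
-/

set_option linter.dupNamespace false

namespace Summit.Langlands.Langlands.Theorems.PrimitiveCompanionReduction

/-- TP holds outright: the route decl `KroneckerCompanionCell` of `PrimitiveCompanionReduction` (text byte-identical to the lens-4 g13
node's `LevelOneDyadic.Primitive.KroneckerCompanionCell`) is the landed theorem `LevelOneDyadic.Primitive.kroneckerCompanionCell_holds`. -/
theorem KroneckerCompanionCell_proof :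
    Summit.Langlands.Langlands.Theses.PrimitiveCompanionReduction.KroneckerCompanionCell := by
  unfold Summit.Langlands.Langlands.Theses.PrimitiveCompanionReduction.KroneckerCompanionCell
  exact Summit.Langlands.Langlands.Theorems.LevelOneDyadic.Primitive.kroneckerCompanionCell_holds

end Summit.Langlands.Langlands.Theorems.PrimitiveCompanionReduction
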